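import Mathlib
import HarnessLib
import HarnessLib.Audit
import Summits.HubbardSuperconductivity.Statement
import HarnessLib.Audit.Status.Attr

/-!
Route: KacWindowPenalty

DORMANT since 2026-08-24T10:45:17Z (reconciler: no traction for 6.7 d (last activity item-evidence-added at 2026-08-17T17:00:06Z); parked, not closed — `ledger route dormant route-HubbardSuperconductivity-KacWindowPenalty --off` to reac) — unstaffed, not closed; items shared with open routes are served there. `ledger route dormant <id> --off` reactivates.

Route KacWindowPenalty — realises idea card `kac-window-penalty-sandwich`
(HubbardSuperconductivity/HubbardSuperconductivity).

## Thesis X (it suffices to show)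
Fix the even torus (ℤ/Lℤ)², the sector K_L = szSector N_L 0 (N_L = 2⌊(1−δ)L²/2⌋) and H_L =
hubbardTorus 2 L 1 U. For a
momentum label m ∈ (ℤ/Lℤ)² (q_m = (2π/L)·valMinAbs m) put Δ_d(m) := Σ_x e^{−2πi m·x/L} P_x (P_x =
localPair dWaveFormFactor L x;
Δ_d(0) = pairField), the KAC-WINDOW PAIR PENALTY W_ε := L⁻² Σ_{|q_m| ≤ ε} Δ_d(m)ᴴ Δ_d(m) (a
positive, translation-invariant
pair–pair repulsion of range ~1/ε and strength O(1) per site) and the window tail of a state ψ,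
T_ε(ψ) := L⁻² Σ_{m ≠ 0, |q_m| ≤ ε}
‖Δ_d(m)ψ‖². Then
  X := ∃ U > 0, δ ∈ (0,1/2), ε, λ, a > 0, σ ≥ 0, L₀ such that for all even L ≥ L₀:
       (gap)  E_L(H_L + λW_ε | K_L) − E_L(H_L | K_L) ≥ λ(σ + a)L²   and   (tail) T_ε(ψ) ≤ σL² for
every normalised sector ground state ψ of H_L.
Lean: decl `Target` of the route file (elaborated, lean check rc 0; E_L(·|K) = Matrix.minEnergyOn,
ground states = IsGroundStateInSector).
X → HubbardSuperconductivity is elementary (decl `TargetImpliesSummit`, support): the one-line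
SANDWICH λ⟨ψ,W_εψ⟩ ≥ E_L(H+λW) − E_L(H)
(decl `Sandwich`: E_L(H+λW|K) ≤ ⟨ψ,(H+λW)ψ⟩ for the ground state ψ ∈ K) gives ⟨ψ,W_εψ⟩ ≥ (σ+a)L²;
subtracting the tail,
L⁻²⟨ψ,Δ_dᴴΔ_dψ⟩ = ⟨ψ,W_εψ⟩ − T_ε(ψ) ≥ aL², i.e. L⁻⁴⟨Δ_dᴴΔ_d⟩ ≥ a for EVERY sector ground state and
every even L ≥ L₀, whence
HasLongRangeOrder along even sides (finite-sum bookkeeping Σ_{x,y}⟨P_xᴴP_y⟩ = ⟨Δ_dᴴΔ_d⟩,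
torusProj_bijOn_halfOpenBox, boundedness
L⁻⁴⟨Δ_dᴴΔ_d⟩ ≤ const for the liminf).

## Two-layer plan
Cruxes first (both closed Lean statements over existing decls, no unproved Literature fact in the
import cone):
  rank 2 `WindowGap`  — ∃ (U,δ) ∀ C ≥ 0 ∀ ε₀ > 0 ∃ ε ∈ (0,ε₀], λ, a > 0, L₀: ∀ even L ≥ L₀:
E_L(H+λW_ε|K) − E_L(H|K) ≥ λ(Cε + a)L²
                        (extensive excess of the penalised ground-state ENERGY DENSITY over any
linear-in-ε tail allowance);
  rank 3 `WindowInfraredBound` — ∀ U > 0, δ ∈ (0,1/2) ∃ C, ε₀, L₀: ∀ ε ∈ (0,ε₀], even L ≥ L₀, sector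
GS ψ: T_ε(ψ) ≤ CεL²
                        (Goldstone-shaped window infrared bound, Σ-form, every ground state).
Glue later: WindowGap → WindowInfraredBound → Target is two lines of logic (σ := Cε); the Assembly
decl is
`WindowGap → WindowInfraredBound → HubbardSuperconductivity`.

Rationale: WHY THIS LINE. Energy-only certificates of pair LRO die by the U(1) phase twist (GSCertificate
stmt-0407; card concavity-normal-form):
penalising the k=0 pair mode shifts the sector ground energy by O(1) (one twist of winding 1 empties
k=0 at cost (1−cos 2π/L)⟨−T_x⟩ = O(1)),
so ENERGY DENSITIES never see LRO. Penalising instead a Kac-range WINDOW |q| ≤ ε of pair momenta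
forces any escaping twist to winding
≥ εL/2π, whose cost is EXTENSIVE (≈ ρ_s ε²L²/2 by the stiffness; ≤ (ε²/2)⟨−T_x⟩ by the f-sum
identity), amplitude suppression costs the
condensation energy density, and phase disorder below scale 1/ε costs ≥ ρ_s ε² per site: every way
to shed window pair weight is extensive.
Hence "every ground state has d-wave LRO" becomes a strict inequality between two
translation-invariant ground-state energy densities,
e(H_U + λW_ε) > e(H_U) + λ(σ + a), plus a weak (Σ-form, window-only) infrared bound — and energy
densities are the one quantity with
two-sided CERTIFIED bounds: lower by Anderson cluster bounds / momentum-resolved moment-SOS-SDP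
hierarchies whose native objective is the
energy (WangEtAl2024 arXiv:2310.05844, FawziFawziScalet2024; W_ε is a PSD quadratic form in the pair
2-RDM, inside those hierarchies without
new variables), upper by explicitly contractible trial states. Imported areas: Kac/mean-field limits
(the ε→0 limit of H+λW_ε sits in the
Bru–de Siqueira Pedra short-range→long-range framework, arXiv:2009.05315, giving a
Lebowitz–Penrose-type handle on a(ε,λ)); generalized
(window) condensation à la van den Berg–Lewis–Pulé / Girardeau1960; KLS1988PRL
sum-rule-minus-IR-bound arithmetic restricted to the
window; certified computation (SDP duality) for the gap. Catalogue entries used: certified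
computation + physical analogy with an explicit
dictionary (Kac range 1/ε ↔ window radius ε; stiffness ↔ twist cost; condensate ↔ m=0 term of W_ε).
RANKED CRUXES. (2) WindowGap [rank 2, hardest: contains "pair stiffness > 0 at some (U,δ)", i.e.
superfluidity of the pure t'=0 model;
λ-free equivalent form: every unit φ ∈ K_L with ⟨φ,W_εφ⟩ ≤ (Cε+a)L² has ⟨φ,H_Lφ⟩ ≥ E_L + cL² (take λ
= c/(Cε+a)) — window-depleted
states lie extensively above the ground energy]. (3) WindowInfraredBound [rank 3: an IR UPPER bound
without reflection positivity; the
statement card yrast-landau-ir-step attacks (S(q) ≤ D(q)/ω_yrast(q)); intended first split in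
tenure: (3a) Pitaevskii–Stringari T=0
inequality S_ψ(q) ≤ ½√(χ_L(q)·f(q)) (PitaevskiiStringari1991; finite-dim, provable now modulo
GS-degeneracy bookkeeping) and (3b) a
uniform static d-wave pair susceptibility bound χ_L(q) ≤ C'L²/q² for 0<|q|≤ε — itself an ENERGY
statement (second-order response of
E_L to the source −h(Δ_d(q)+Δ_d(q)ᴴ)), which would make both cruxes energy-density statements].
Supports: Sandwich (finite-dim
variational lemma, provable now), TargetImpliesSummit (sandwich + subtraction + even-side liminf
bookkeeping, provable now; cf.
WeakCouplingBCS stmt-0160). Lemmas provers may attach with --supports WindowGap: the exact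
twist/f-sum identity
⟨U_jψ,H U_jψ⟩ − ⟨ψ,Hψ⟩ = (1−cos(2πj/L))⟨−T_x⟩_ψ + sin(2πj/L)⟨J_x⟩_ψ (CAR algebra), and WindowGap ⇒
positivity of the window-depletion cost.
KILL CRITERIA. (i) A proof that for all U>0, δ, ε, λ: E_L(H+λW_ε) − E_L(H) ≤ λ·sup_{GS ψ}T_ε(ψ) +
o(L²) (no excess beyond the tail anywhere:
¬Target) closes the route and is a theorem for route NoGo. (ii) A twist-type construction showing
E_L(H+λW_ε) − E_L(H) = o(L²) whenever
the GS has LRO (the window does NOT make the loophole extensive) refutes WindowGap's mechanism —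
close. (iii) WindowInfraredBound refuted
by an explicit (U,δ) with extensive small-momentum pair weight in some GS sequence (pair-density
wave inside every window / phase
separation with superconducting puddles) → restate (3) on an explicit parameter box excluding it,
once; twice → close.
(iv) Certified SDP lower bounds at levels reachable in practice sit ≥ 10⁻² t/site below variational
upper bounds at every tried
(U,δ,ε,λ) with U ∈ [2,8], δ ∈ [0.1,0.35] (needed margin λaL² ≈ ρ_sε²L²/4 ~ 10⁻³ t/site) → route
dormant, not closed (precision, not principle).
REGIME. Weak coupling is excluded in practice (LRO ≤ C U log(1/U)-type ceilings, margin invisible);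
the bet is intermediate U ≈ 2–6,
δ ≈ 0.15–0.3, where PureModelStripeCompetition (QinEtAl2020: no SC at U=8, δ=1/8, t'=0; XuEtAl2024)
is the live physical risk.
DELIBERATELY NOT DECOMPOSED YET: the split of (3) into (3a)+(3b); any decomposition of (2) into
stiffness + condensation-energy +
form-factor-rigidity pieces (the penalty sees only the NN-bond B1g harmonic; hiding the condensate
in higher d-wave harmonics must be shown
to cost energy density); the certified-numerics pipeline (choice of smooth window cutoff, SDP level,
rational rounding); GS-degeneracy
bookkeeping for "every" ground state (bounded sector degeneracy at generic U).

Novelty: Nearest prior art (searched for the card on 2026-08-15 by its author and by two refuter novelty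
audits, re-checked this pass):
(A) certified ground-state observables from an SDP energy LOWER bound plus a variational UPPER bound
— WangEtAl2024 (arXiv:2310.05844,
PRX 14:031006), FawziFawziScalet2024 (doi:10.1038/s41467-024-51592-3), and "Bootstrapping quantum
Hamiltonians with symmetry"
(arXiv:2410.00810): the Feynman–Hellmann/variational sandwich ⟨ψ,Wψ⟩ ≥ (E(H+λW) − E(H))/λ is their
device, applied to local observables;
(B) generalized (momentum-band) condensation |q| ≤ ε — Girardeau1960, van den Berg–Lewis–Pulé 1986;
(C) sum rule minus infrared bound —
KLS1988PRL (needs reflection positivity for the IR bound at every k ≠ 0); (D) the q = 0 penalty and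
its failure by the U(1) twist —
KomaTasaki1994 §2 / GSCertificate stmt-0407 / card concavity-normal-form; (E) Kac limits for lattice
fermions — Bru–de Siqueira Pedra
(arXiv:2009.05315, arXiv:1608.08441: free energies, no order-parameter windows). Searches this pass:
`lit search --hybrid "momentum window
pair repulsion penalty ground state energy lower bound long-range order superconductor"` (8 textbook
hits, none relevant: xiang2022,
annett2004, fradkin2013 …), `lit frontier HubbardSuperconductivity --since 2021` (30 rows; only
arXiv:2410.00810 bears on the certificate
leg), arXiv/galaxy legs rate-limited/saturated (429 / queue > 90 s) — recorded in NOTES. DELTA: no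
source joins (A)–(D) into a finite
momentum WINDOW pair penalty  [refs: 10.1038/s41467-024-51592-3, 2310.05844, 2410.00810, 2009.05315, 1608.08441, doi:10.1038/s41467-024-51592-3, WangEtAl2024, FawziFawziScalet2024, Girardeau1960, KomaTasaki1994]

Barriers (technique_class: Kac-window-penalty certified-energy-bounds IR-bound): technique_class: Kac-window-penalty certified-energy-bounds IR-bound
Literature.Barriers.HubbardSuperconductivity.LROForcesLowLyingStates: the design target, not evaded
by assumption — tower/twist states make any q=0 pair penalty cost O(1) in total (GSCertificate
stmt-0407); the window |q| ≤ ε forces escaping twists to winding ≥ εL/2π whose cost is extensive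
(stiffness/f-sum), and crux WindowGap must PROVE that cost; the order is stated as LRO of ⟨Δ_dᴴΔ_d⟩
in symmetric sector ground states (evasion (i) of the entry), never as ⟨Δ_d⟩ ≠ 0.
Literature.Barriers.HubbardSuperconductivity.GeneralizedHartreeFockNoPairing: touches only the
UPPER-bound side of the certified margin — quasi-free trial states carry no pairing energy at bare U
> 0, so e(H_U) must be bounded above by correlated yet exactly contractible states
(Gutzwiller/Jastrow-projected determinants evaluated exactly on finite tori, fermionic PEPS of small
bond dimension) or the margin is eaten by the HF error; the route's certificate is never "pairing
lowers a gHF energy".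
Literature.Barriers.HubbardSuperconductivity.PureModelStripeCompetition: the live physical risk — at
(U,δ) = (8,1/8), t'=0 the pure model is numerically non-superconducting (QinEtAl2020, XuEtAl2024),
so WindowGap would be false there; the route targets U ≈ 2–6, δ ≈ 0.15–0.3 and never uses the
cuprate-regime witness class; if the pure model has no d-wave order at any certifiable (U,δ), kill
criterion (iv)/(i) applies.
Literature.Barriers.HubbardSupercond

Novelty grade: new-combination — ROUTE REVIEW (refuter 40af5994, 2026-08-15). VERDICT: sound, keep open. ELAB: all 6 bodies rc0 as verbatim copies under the route's imports (probe V_hub.lean; module farm-unbuilt rc75 all session). PRECISION: quantifier orders = informal thesis; no junk (minEnergyOn sInf-junk only at K=⊥, excluded s (refuter refuter-rreview-route-HubbardSuperconduc-40af5994-0, 2026-08-15T11:15:34Z; prior: arXiv:2310.05844 (WangEtAl2024: SDP energy lower bound + variational upper bound sandwich), doi:10.1038/s41467-024-51592-3 (FawziFawziScalet2024), KLS1988PRL (sum rule minus IR bound, needs RP), KomaTasaki1994 §2 (q=0 penalty vs U(1) twist), Girardeau1960 / van den Berg–Lewis–Pulé 1986 (momentum-band condensation), arXiv:2009.05315 (Bru–de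 Siqueira Pedra, Kac limits for lattice fermions))

History (route lifecycle, newest last):
- 2026-08-24T10:45:17Z · DORMANT — reconciler: no traction for 6.7 d (last activity item-evidence-added at 2026-08-17T17:00:06Z); parked, not closed — `ledger route dormant route-HubbardSupercond (operator:999:3774309)

sub-problem: HubbardSuperconductivity · status: dormant · opened planner-plancard-HubbardSuperconductivity-Hub-fee77e98-0 2026-08-15T10:50:48Z · rev 3 · ledger route-HubbardSuperconductivity-KacWindowPenalty
GENERATED by the gate from the ledger (D-0016/17). Provers cite these decls: `theorem foo : Summit.HubbardSuperconductivity.HubbardSuperconductivity.Theses.KacWindowPenalty.<Decl> := …` in Summits/HubbardSuperconductivity/HubbardSuperconductivity/Theorems/<Name>.lean.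
-/

namespace Summit.HubbardSuperconductivity.HubbardSuperconductivity.Theses.KacWindowPenalty

open scoped BigOperators Topology Manifold Classical MeasureTheory ProbabilityTheory Matrix InnerProductSpace ComplexConjugate ContinuousMap
open Filter Set Function TopologicalSpace MeasureTheory

attribute [summit_statement] _root_.HubbardSuperconductivity

open Literature.Hubbard

/-- item stmt-HubbardSuperconductivity-1087 · target · rank 0 · open · by planner
why it might fail: X = both cruxes at one (U,δ): fails if the pure t'=0 model has no stiff d-wave condensate anywhere (none at U≈6–8, 0.1<δ<0.2: QinEtAl2020; mVMC sees SC only inside the phase-separated region U/t>6: MisawaImada2014, where the tail bound fails), or if sector GS degeneracy grows with L ('every GS').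
sources: QinEtAl2020, MisawaImada2014, RaghuKivelsonScalapino2010, WangEtAl2024, KomaTasaki1994
[target] X of route KacWindowPenalty (card kac-window-penalty-sandwich). Notation (all inside the
signature as `let`s): D m := Σ_x exp(−2πi (m·x)/L) • localPair dWaveFormFactor L x is the momentum-m
d-wave pair field on the even torus (D 0 = pairField), q_m := (2π/L)·valMinAbs m, W := L⁻² Σ_{|q_m|
≤ ε} (D m)ᴴ(D m) the Kac-window pair penalty (PSD, translation invariant, range ~1/ε, number- and
S^z-conserving), T_ε(ψ) := L⁻² Σ_{m≠0, |q_m|≤ε} ‖(D m)ψ‖² the window tail. CLAIM: ∃ U>0, δ∈(0,1/2),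
ε, λ, a > 0, σ ≥ 0, L₀: for all even L ≥ L₀, (gap) minEnergyOn (H_L + λW) K_L − minEnergyOn H_L K_L
≥ λ(σ+a)L² with H_L = hubbardTorus 2 L 1 U, K_L = szSector N_L 0, N_L = 2⌊(1−δ)L²/2⌋, and (tail)
T_ε(ψ) ≤ σL² for every normalised sector ground state ψ. X → HubbardSuperconductivity is item
TargetImpliesSummit (sandwich + subtraction). Follows from WindowGap ∧ WindowInfraredBound with σ :=
Cε. why it might fail: see the two cruxes — no excess beyond the tail if the pure t'=0 model has no
stiff d-wave condensate at any (U,δ), and the tail may not be O(ε) per site without reflection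
positivity. Sources: card kac-window-penalty-sandwich; WangEtAl2024; KLS1988PRL; KomaTasaki1994. -/
@[route_item "route-HubbardSuperconductivity-KacWindowPenalty"]
def Target : Prop :=
  ∃ U : ℝ, 0 < U ∧ ∃ δ ∈ Set.Ioo (0:ℝ) (1 / 2), ∃ ε lam σ a : ℝ, 0 < ε ∧ 0 < lam ∧ 0 ≤ σ ∧ 0 < a ∧ ∃ L₀ : ℕ, ∀ (L : ℕ) [NeZero L], L₀ ≤ L → Even L → let D : (Fin 2 → ZMod L) → Matrix (Finset (Literature.MathematicalPhysics.QuantumLattice.Orb (Literature.MathematicalPhysics.QuantumLattice.FermionTorus 2 L))) (Finset (Literature.MathematicalPhysics.QuantumLattice.Orb (Literature.MathematicalPhysics.QuantumLattice.FermionTorus 2 L))) ℂ := fun m => ∑ x : Fin 2 → ZMod L, Complex.exp (-(2 * Real.pi * Complex.I * (((∑ i : Fin 2, m i * x i).val : ℕ) : ℂ) / (L : ℂ))) • Literature.MathematicalPhysics.QuantumLattice.localPair Literature.MathematicalPhysics.QuantumLattice.dWaveFormFactor L x; let W : Matrix (Finset (Literature.MathematicalPhysics.QuantumLattice.Orb (Literature.MathematicalPhysics.QuantumLattice.FermionTorus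 2 L))) (Finset (Literature.MathematicalPhysics.QuantumLattice.Orb (Literature.MathematicalPhysics.QuantumLattice.FermionTorus 2 L))) ℂ := ∑ m : Fin 2 → ZMod L, if (2 * Real.pi / (L : ℝ)) ^ 2 * (∑ i : Fin 2, (((m i).valMinAbs : ℤ) : ℝ) ^ 2) ≤ ε ^ 2 then ((L : ℂ) ^ 2)⁻¹ • (Matrix.conjTranspose (D m) * D m) else 0; lam * (σ + a) * (L : ℝ) ^ 2 ≤ ((Literature.MathematicalPhysics.QuantumLattice.hubbardTorus 2 L 1 U + (lam : ℂ) • W).minEnergyOn (Literature.MathematicalPhysics.QuantumLattice.szSector (2 * ⌊(1 - δ) * (L : ℝ) ^ 2 / 2⌋₊) 0) - (Literature.MathematicalPhysics.QuantumLattice.hubbardTorus 2 L 1 U).minEnergyOn (Literature.MathematicalPhysics.QuantumLattice.szSector (2 * ⌊(1 - δ) * (L : ℝ) ^ 2 / 2⌋₊) 0)) ∧ ∀ ψ : Literature.MathematicalPhysics.QuantumLattice.Fock (Literature.MathematicalPhysics.QuantumLattice.Orb (Literature.MathematicalPhysics.QuantumLattice.FermionTorus 2 L)), star ψ ⬝ᵥ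 ψ = 1 → Literature.MathematicalPhysics.QuantumLattice.IsGroundStateInSector (Literature.MathematicalPhysics.QuantumLattice.hubbardTorus 2 L 1 U) (2 * ⌊(1 - δ) * (L : ℝ) ^ 2 / 2⌋₊) 0 ψ → (∑ m : Fin 2 → ZMod L, if m ≠ 0 ∧ (2 * Real.pi / (L : ℝ)) ^ 2 * (∑ i : Fin 2, (((m i).valMinAbs : ℤ) : ℝ) ^ 2) ≤ ε ^ 2 then (star (Matrix.mulVec (D m) ψ) ⬝ᵥ Matrix.mulVec (D m) ψ).re / (L : ℝ) ^ 2 else 0) ≤ σ * (L : ℝ) ^ 2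

/-- item stmt-HubbardSuperconductivity-1088 · crux · rank 2 · open · by planner
why it might fail: Needs ρ_s>0 and d-wave LRO in EVERY sector GS of the pure t'=0 model at one (U,δ), unif. in L: no SC at U≈6–8, 0.1<δ<0.2 (QinEtAl2020) nor U/t≲6 (MisawaImada2014: SC only with phase separation); weak-coupling KL order unproved (RaghuKivelsonScalapino2010); if λp₀>ρ_sε²/2 condensate hops to |q|>ε.
sources: QinEtAl2020, MisawaImada2014, RaghuKivelsonScalapino2010, XuEtAl2024, KomaTasaki1994, arXiv:2009.05315
[crux] EXTENSIVE WINDOW EXCESS (card step (2); the physics; hardest). ∃ U>0, δ∈(0,1/2) such that ∀ C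
≥ 0, ∀ ε₀ > 0, ∃ ε ∈ (0,ε₀], λ > 0, a > 0, L₀ with, for all even L ≥ L₀:  minEnergyOn (H_L + λW_ε)
K_L − minEnergyOn H_L K_L ≥ λ(Cε + a)L²  (W_ε, K_L, N_L as in Target; C is the tail allowance that
WindowInfraredBound will supply, hence the ∀C — ε is chosen after C). λ-FREE EQUIVALENT (up to
constants): every unit φ ∈ K_L with ⟨φ,W_εφ⟩ ≤ (Cε+a)L² has ⟨φ,H_Lφ⟩ ≥ E_L + cL² (take λ =
c/(Cε+a)): depleting the small-momentum d-wave pair weight below its ground-state value costs ENERGY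
DENSITY. Heuristic (card): the penalised state can shed window weight only by (i) suppressing the
pair amplitude (cost ≈ condensation energy density e_cond), (ii) phase disorder below scale 1/ε
(cost ≥ ρ_s ε² per site), (iii) moving the condensate to |q| > ε — a twist of winding j ≥ εL/2π
costs (1−cos 2πj/L)⟨−T_x⟩ ≈ ρ_s ε² L²/2 (extensive, unlike the q=0 penalty where j=1 costs O(1):
GSCertificate stmt-0407), (iv) hiding the condensate in higher B1g harmonics (cos 2k_x − cos 2k_y,
longer bonds) invisible to the NN-bond form factor — must cost O(e_cond) if the pairing glue is
short ranged; expected a ≈ LRO·( -/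
@[route_item "route-HubbardSuperconductivity-KacWindowPenalty", crux]
def WindowGap : Prop :=
  ∃ U : ℝ, 0 < U ∧ ∃ δ ∈ Set.Ioo (0:ℝ) (1 / 2), ∀ C : ℝ, 0 ≤ C → ∀ ε₀ : ℝ, 0 < ε₀ → ∃ ε ∈ Set.Ioc (0:ℝ) ε₀, ∃ lam a : ℝ, 0 < lam ∧ 0 < a ∧ ∃ L₀ : ℕ, ∀ (L : ℕ) [NeZero L], L₀ ≤ L → Even L → let D : (Fin 2 → ZMod L) → Matrix (Finset (Literature.MathematicalPhysics.QuantumLattice.Orb (Literature.MathematicalPhysics.QuantumLattice.FermionTorus 2 L))) (Finset (Literature.MathematicalPhysics.QuantumLattice.Orb (Literature.MathematicalPhysics.QuantumLattice.FermionTorus 2 L))) ℂ := fun m => ∑ x : Fin 2 → ZMod L, Complex.exp (-(2 * Real.pi * Complex.I * (((∑ i : Fin 2, m i * x i).val : ℕ) : ℂ) / (L : ℂ))) • Literature.MathematicalPhysics.QuantumLattice.localPair Literature.MathematicalPhysics.QuantumLattice.dWaveFormFactor L x; let W : Matrix (Finset (Literature.MathematicalPhysics.QuantumLattice.Orb (Literature.MathematicalPhysics.QuantumLattice.FermionTorus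 2 L))) (Finset (Literature.MathematicalPhysics.QuantumLattice.Orb (Literature.MathematicalPhysics.QuantumLattice.FermionTorus 2 L))) ℂ := ∑ m : Fin 2 → ZMod L, if (2 * Real.pi / (L : ℝ)) ^ 2 * (∑ i : Fin 2, (((m i).valMinAbs : ℤ) : ℝ) ^ 2) ≤ ε ^ 2 then ((L : ℂ) ^ 2)⁻¹ • (Matrix.conjTranspose (D m) * D m) else 0; lam * (C * ε + a) * (L : ℝ) ^ 2 ≤ ((Literature.MathematicalPhysics.QuantumLattice.hubbardTorus 2 L 1 U + (lam : ℂ) • W).minEnergyOn (Literature.MathematicalPhysics.QuantumLattice.szSector (2 * ⌊(1 - δ) * (L : ℝ) ^ 2 / 2⌋₊) 0) - (Literature.MathematicalPhysics.QuantumLattice.hubbardTorus 2 L 1 U).minEnergyOn (Literature.MathematicalPhysics.QuantumLattice.szSector (2 * ⌊(1 - δ) * (L : ℝ) ^ 2 / 2⌋₊) 0))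

/-- item stmt-HubbardSuperconductivity-1089 · crux · rank 3 · open · by planner
why it might fail: Stated ∀U>0 ∀δ: ONE (U,δ) whose GS phase-separates with a paired component has S_ψ(q)~pL² at |q|~2π/L, so T_ε≥cpL²≫CεL² — mVMC claims this at U/t=10, δ≲0.2 (MisawaImada2014); no T=0 infrared upper bound known without reflection positivity (KLS1988PRL, Tasaki2020); needs GS degeneracy bounded in L.
sources: MisawaImada2014, KLS1988PRL, Tasaki2020, PitaevskiiStringari1991, KomaTasaki1994
[crux] WINDOW INFRARED BOUND, Σ-form, every ground state (card step (3)). ∀ U > 0, δ ∈ (0,1/2) ∃ C ≥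
0, ε₀ > 0, L₀: ∀ ε ∈ (0,ε₀], ∀ even L ≥ L₀, ∀ normalised sector ground states ψ of H_L:  T_ε(ψ) =
L⁻² Σ_{m≠0, |q_m|≤ε} ‖Δ_d(m)ψ‖² ≤ C ε L². This is the Goldstone shape S_ψ(q) := L⁻²‖Δ_d(m)ψ‖² ≲
c/|q| summed over the ≈ ε²L²/4π window momenta (a flat S_ψ(q) ≤ c gives the stronger Cε²); it says:
no macroscopic d-wave pair weight at small NONZERO momenta in any sector ground state — no
pair-density wave inside the window, no phase separation into superconducting puddles, phase
fluctuations no softer than a linear Goldstone mode. Pointwise in (U,δ) (constants may blow up near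
phase boundaries). ENGINE QUESTION: T=0 infrared UPPER bounds are known only via reflection
positivity (KLS1988PRL; Tasaki2020) and the doped Hubbard model is not RP. Intended tenure split:
(3a) Pitaevskii–Stringari T=0 inequality S_ψ(q)L² ≤ ½√(χ_L(q) f_L(q)) with f the double commutator
⟨[[Δ_d(m)ᴴ,H],Δ_d(m)]⟩ = O(L²) (finite-dimensional; the GS-degenerate part of Δ_d(m)ψ needs separate
bookkeeping) and (3b) a uniform static pair-susceptibility bound χ_L(q) ≤ C'L²/|q|² on the window,
an ENERGY statement (second-orde -/
@[route_item "route-HubbardSuperconductivity-KacWindowPenalty", crux]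
def WindowInfraredBound : Prop :=
  ∀ U : ℝ, 0 < U → ∀ δ ∈ Set.Ioo (0:ℝ) (1 / 2), ∃ C ε₀ : ℝ, 0 ≤ C ∧ 0 < ε₀ ∧ ∃ L₀ : ℕ, ∀ ε ∈ Set.Ioc (0:ℝ) ε₀, ∀ (L : ℕ) [NeZero L], L₀ ≤ L → Even L → let D : (Fin 2 → ZMod L) → Matrix (Finset (Literature.MathematicalPhysics.QuantumLattice.Orb (Literature.MathematicalPhysics.QuantumLattice.FermionTorus 2 L))) (Finset (Literature.MathematicalPhysics.QuantumLattice.Orb (Literature.MathematicalPhysics.QuantumLattice.FermionTorus 2 L))) ℂ := fun m => ∑ x : Fin 2 → ZMod L, Complex.exp (-(2 * Real.pi * Complex.I * (((∑ i : Fin 2, m i * x i).val : ℕ) : ℂ) / (L : ℂ))) • Literature.MathematicalPhysics.QuantumLattice.localPair Literature.MathematicalPhysics.QuantumLattice.dWaveFormFactor L x; ∀ ψ : Literature.MathematicalPhysics.QuantumLattice.Fock (Literature.MathematicalPhysics.QuantumLattice.Orb (Literature.MathematicalPhysics.QuantumLattice.FermionTorus 2 L)), star ψ ⬝ᵥ ψ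 = 1 → Literature.MathematicalPhysics.QuantumLattice.IsGroundStateInSector (Literature.MathematicalPhysics.QuantumLattice.hubbardTorus 2 L 1 U) (2 * ⌊(1 - δ) * (L : ℝ) ^ 2 / 2⌋₊) 0 ψ → (∑ m : Fin 2 → ZMod L, if m ≠ 0 ∧ (2 * Real.pi / (L : ℝ)) ^ 2 * (∑ i : Fin 2, (((m i).valMinAbs : ℤ) : ℝ) ^ 2) ≤ ε ^ 2 then (star (Matrix.mulVec (D m) ψ) ⬝ᵥ Matrix.mulVec (D m) ψ).re / (L : ℝ) ^ 2 else 0) ≤ C * ε * (L : ℝ) ^ 2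

/-- item stmt-HubbardSuperconductivity-1090 · support · rank 9 · closed · proved by Summit.HubbardSuperconductivity.HubbardSuperconductivity.Theorems.kacWindowPenalty_sandwich_proof @ db3721d48381 (prover) · by planner
sources: WangEtAl2024, Tasaki2020
[support] SANDWICH / Feynman–Hellmann variational lemma (card step (1); finite-dimensional, provable
now, no hermiticity or sector invariance needed): for matrices H, A on a finite index type, a
subspace K, a unit vector ψ ∈ K with Hψ = (minEnergyOn H K)•ψ and λ > 0:  minEnergyOn (H + λA) K −
minEnergyOn H K ≤ λ·Re⟨ψ, Aψ⟩. Proof: minEnergyOn (H+λA) K ≤ Re⟨ψ,(H+λA)ψ⟩ (ψ is admissible in the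
defining sInf; the set is bounded below by −‖H+λA‖ on the unit sphere) = Re⟨ψ,Hψ⟩ + λRe⟨ψ,Aψ⟩ and
Re⟨ψ,Hψ⟩ = minEnergyOn H K by the eigen-equation and ‖ψ‖ = 1. Used by TargetImpliesSummit with n =
Finset (Orb (FermionTorus 2 L)), K = szSector N_L 0, A = W_ε. Sources: WangEtAl2024 §II (certified
observables from energy bounds); Tasaki2020 §2.1 (variational principle). -/
@[route_item "route-HubbardSuperconductivity-KacWindowPenalty"]
def Sandwich : Prop :=
  ∀ (n : Type) [Fintype n] [DecidableEq n] (H A : Matrix n n ℂ) (K : Submodule ℂ (n → ℂ)) (ψ : n → ℂ) (lam : ℝ), 0 < lam → ψ ∈ K → star ψ ⬝ᵥ ψ = 1 → Matrix.mulVec H ψ = ((H.minEnergyOn K : ℝ) : ℂ) • ψ → (H + (lam : ℂ) • A).minEnergyOn K - H.minEnergyOn K ≤ lam * (star ψ ⬝ᵥ Matrix.mulVec A ψ).re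

/-- item stmt-HubbardSuperconductivity-1091 · support · rank 9 · closed · proved by Summit.HubbardSuperconductivity.HubbardSuperconductivity.Theorems.kacWindowPenalty_targetImpliesSummit_proof @ 0a94412e57e9 (prover) · by planner
sources: Scalapino1995, WangEtAl2024
[support] X → HubbardSuperconductivity (elementary; provable now). Given the summit hypotheses (N, ψ
with N L = N_L, ‖ψ_L‖ = 1, IsGroundStateInSector (hubbardTorus 2 L 1 U) (N L) 0 (ψ L) for even L)
and Target's data (U, δ, ε, λ, σ, a, L₀): for even L ≥ max(L₀,2), Sandwich with A = W gives
λ⟨ψ_L,Wψ_L⟩.re ≥ gap ≥ λ(σ+a)L², so ⟨ψ_L,Wψ_L⟩.re ≥ (σ+a)L²; split the window sum at m = 0: D 0 =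
pairField dWaveFormFactor L (the phase is exp 0 = 1), hence ⟨ψ,Wψ⟩.re =
L⁻²Re⟨ψ,(pairField)ᴴ(pairField)ψ⟩ + T_ε(ψ) and with (tail) L⁻⁴Re⟨ψ_L,Δ_dᴴΔ_dψ_L⟩ ≥ a. Bookkeeping to
the summit's conclusion HasLongRangeOrder (fun k => halfOpenBox 2 (2k)) (fun k => torusPullback
(pairFieldCorr dWaveFormFactor ψ) (2k)): Σ_{x,y ∈ halfOpenBox 2 (2k)} pairFieldCorr … (proj x) (proj
y) = Σ_{x,y : TorusSite} Re⟨ψ,(P_x)ᴴP_yψ⟩ (torusProj_bijOn_halfOpenBox) = Re⟨ψ,Δ_dᴴΔ_dψ⟩ (pairField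
= Σ_x P_x, bilinearity), card (halfOpenBox 2 (2k)) = (2k)², so the k-th term is ≥ a for 2k ≥
max(L₀,2); the sequence is bounded above (‖P_x‖ ≤ const ⇒ L⁻⁴⟨Δ_dᴴΔ_d⟩ ≤ const), so 0 < a ≤ liminf.
Cf. WeakCouplingBCS stmt-0160 / GSCertificate stmt-0181 for the same tail-end bookkeeping. Sources:
Scalapino1995 §2 (2.4); card kac-window-penalty- -/
@[route_item "route-HubbardSuperconductivity-KacWindowPenalty", crux]
def TargetImpliesSummit : Prop :=
  Target → HubbardSuperconductivity

/-- item stmt-HubbardSuperconductivity-14282 · support · rank 9 · closed · proved by Summit.HubbardSuperconductivity.HubbardSuperconductivity.Theorems.kacWindowPenalty_targetOfCruxes_proof @ 0a94412e57e9 (prover) · by planner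
[support] GLUE to the target (route-choice repair 2026-08-16, target reachability; option (a) of the
operator hold): the two cruxes give X — WindowGap → WindowInfraredBound → Target. Pure logic,
provable now by anyone idle: take (U,δ) from WindowGap (rank 2); WindowInfraredBound (rank 3) at
(U,δ) gives C ≥ 0, ε₀ > 0, L₁; WindowGap at (C, ε₀) gives ε ∈ (0,ε₀], λ, a > 0, L₀; Target holds
with σ := C·ε (σ ≥ 0 by mul_nonneg) and threshold max L₀ L₁ — the `let D`/`let W` terms of the three
statements are syntactically identical, so the (gap) conjunct is WindowGap's inequality verbatim
(λ(Cε+a)L² ≤ …) and the (tail) conjunct is WindowInfraredBound's bound at this ε (≤ CεL² = σL²).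
Planner Sketch.lean: the signature elaborates in the route namespace and the 8-line term (the body
of the certified deciding theorem `closes` minus its first line `apply hTS`) proves it, lean check
rc 0, axioms propext / Classical.choice / Quot.sound. It carries no mathematical content and does
not touch `closes : WindowGap → WindowInfraredBound → TargetImpliesSummit →
HubbardSuperconductivity` (certified, authority native), which consumes the two cruxes directly;
with this item the target X (rank 0) is reached -/
@[route_item "route-HubbardSuperconductivity-KacWindowPenalty"]
def TargetOfCruxes : Prop :=
  WindowGap → WindowInfraredBound → Target

/-- item stmt-HubbardSuperconductivity-1092 · assembly · rank 1 · closed · proved by Summit.HubbardSuperconductivity.HubbardSuperconductivity.Theorems.kacWindowPenalty_assembly_proof @ 0a94412e57e9 (prover) · by planner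
sources: Scalapino1995, KLS1988PRL
[assembly] WindowGap → WindowInfraredBound → HubbardSuperconductivity. Glue (two lines): take (U,δ)
from WindowGap; WindowInfraredBound at (U,δ) gives C, ε₀, L₁; WindowGap at (C, ε₀) gives ε ≤ ε₀, λ,
a, L₀; Target holds with σ := Cε and max(L₀,L₁) (the `let D`/`let W` terms of the three statements
are syntactically identical); finish with TargetImpliesSummit. Sources: card
kac-window-penalty-sandwich; Scalapino1995. -/
@[route_item "route-HubbardSuperconductivity-KacWindowPenalty"]
def Assembly : Prop :=
  WindowGap → WindowInfraredBound → HubbardSuperconductivity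

/-! D-0027 §2.1 — DECIDING THEOREM (planner-authored via `route open/edit --closes-file`; by planner-rbadge-HubbardSuperconductivity-KacWin-43d818db-g2-0 2026-08-15T16:11:11Z):
its hypotheses are this route's items and its conclusion the sub-problem Statement (glue_lint), and it elaborates with this file. -/

@[closes "route-HubbardSuperconductivity-KacWindowPenalty"] theorem closes (hGap : WindowGap) (hIR : WindowInfraredBound) (hTS : TargetImpliesSummit) :
    _root_.HubbardSuperconductivity := by
  apply hTS
  obtain ⟨U, hU, δ, hδ, hG⟩ := hGap
  obtain ⟨C, ε₀, hC, hε₀, L₁, hI⟩ := hIR U hU δ hδ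
  obtain ⟨ε, hε, lam, a, hlam, ha, L₀, hG⟩ := hG C hC ε₀ hε₀
  refine ⟨U, hU, δ, hδ, ε, lam, C * ε, a, hε.1, hlam, mul_nonneg hC hε.1.le, ha, max L₀ L₁, ?_⟩
  intro L _ hL hEven
  exact ⟨hG L (le_of_max_le_left hL) hEven,
    fun ψ hψ hGS => hI ε hε L (le_of_max_le_right hL) hEven ψ hψ hGS⟩

end Summit.HubbardSuperconductivity.HubbardSuperconductivity.Theses.KacWindowPenalty
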